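import Summits.CriticalPhenomena.PercolationContinuityZ3.Theorems.Transplant.FKConnectivityAllQAntipodalRootFormRealBox
import Summits.CriticalPhenomena.PercolationContinuityZ3.Theorems.Transplant.FKConnectivityAllQAntipodalOrAttSides
import Summits.CriticalPhenomena.PercolationContinuityZ3.Theorems.Transplant.FKConnectivityAllQAntipodalMajMixNested
import HarnessLib

/-!
# Connectivity correlation inequalities for `φ_{w,q}`, every `q > 0` — ROOT-FORM CALCULUS, file 61p: the three AND FACTS of a real
# two-special environment (root deleted / contracted / free-nested), for EVERY two-terminal series–parallel edge set

Support file (`--supports stmt-CriticalPhenomena-4575`), FK sub-lane `prim-bschramm-fk-2` (gen 29); builds on p205010 (kernel theorem,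
internal audit signed; external expert review pending).  No definitions, no named facts, no sorries; standard axioms.  Memo
FROM-fk-2-g28-ROOT-FORM.md §4, §7 (L4b); FK-Q2 §37–§38.

Facts 3–5 of the word theorem (`FK.RootForm.spine_facts`) for the real environment `realEnv M C a b y z` of a two-terminal series–parallel
edge set `F` between `a, b` containing the special edges `y, z`, cell `M` free / `C` contracted (disjoint, inside `F \ {y,z}`):
* `realEnv_andDel_nonneg` — `Σ_β h(β)([Λ_∅ ≤ J] − [Λ_yz ≤ J]) ≥ 0` (root deleted): the master weighted AND theorem in rootless form
  (`FK.andGenW_rootless_nonpos_of_isTTSP`) on `F` with AND set `{y,z}` and level weight `1{· ≤ J}`;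
* `realEnv_andCon_nonneg` — the same with the poles identified (`Λ + K¹ + K²`): the rootless AND theorem on `j F ∪ {j a ⋆, ⋆ j b}` along
  `some : V ↪ Option V` with the apex path contracted (`FK.isTTSP_map_apex`, `FK.clusterCount_insert_apex₂`);
* `realEnv_andFree_nonneg` — the nested free-root AND (`h₁·[Λ + K¹ ≤ J]`-part with the root in replica 1, `h₀·[Λ + K² ≤ J]`-part with it in
  replica 2, `h₀ ≤ h₁`): the rootless AND theorem on the same apex host with the apex edge `j a ⋆` FREE (glued test function) and `⋆ j b` contracted.
No hypothesis on the pole pair `ab` is needed.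
[cite: Grimmett2006, §1.4 eq. (1.20) (p. 15); §3.8 Thm. (3.90) (pp. 61–62); §3.9 (pp. 63–64)] [cite: Wagner2006, Thm. 5.8(d), §5.3]
-/

noncomputable section

namespace Summit.CriticalPhenomena.PercolationContinuityZ3.Theorems

namespace FK

namespace RootForm

open SimpleGraph Finset Literature.Probability.LatticeModels Literature.Probability.Percolation
open scoped Classical

variable {V : Type*} [Fintype V]

section AndDel

variable {F M C : Finset (Sym2 V)} {a b uy vy uz vz : V}

/-- the indicator level weight `1{· ≤ J}` (shifted by `κ`) is antitone. [folklore] -/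
theorem levelWeight_antitone (κ J : ℤ) : ∀ n : ℕ, (if ((n + 1 : ℕ) : ℤ) + κ ≤ J then (1 : ℝ) else 0) ≤
    (if (n : ℤ) + κ ≤ J then (1 : ℝ) else 0) := by
  intro n
  split_ifs with h1 h2
  · exact le_rfl
  · push_cast at h1; omega
  · exact zero_le_one
  · exact le_rfl

omit [Fintype V] in
/-- The extension `X ↦ h(X ∩ M)` of a monotone weight on `↥M.powerset` is monotone on all edge sets. [folklore] -/
theorem extWeight_mono {h : ↥M.powerset → ℝ} (mh : Monotone h) :
    ∀ ⦃X Y : Finset (Sym2 V)⦄, X ⊆ Y → Y ⊆ M →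
      h ⟨X ∩ M, Finset.mem_powerset.2 Finset.inter_subset_right⟩ ≤ h ⟨Y ∩ M, Finset.mem_powerset.2 Finset.inter_subset_right⟩ :=
  fun _ _ hXY _ => mh (show (⟨_, _⟩ : ↥M.powerset) ≤ ⟨_, _⟩ from Finset.inter_subset_inter hXY le_rfl)

omit [Fintype V] in
/-- The extension agrees with `h` on `↥M.powerset`. [folklore] -/
theorem extWeight_apply (h : ↥M.powerset → ℝ) (β : ↥M.powerset) :
    h ⟨β.1 ∩ M, Finset.mem_powerset.2 Finset.inter_subset_right⟩ = h β := by
  congr 1; exact Subtype.ext (Finset.inter_eq_left.2 (Finset.mem_powerset.1 β.2))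

/-- **Fact 3 (deleted root) for a real environment**: `0 ≤ Σ_β h(β)·([Λ_∅(β) ≤ J] − [Λ_yz(β) ≤ J])` for every monotone `h` — the rootless
master AND theorem on `F` with AND set `{y, z}`. [cite: Grimmett2006, §3.8 Thm. (3.90) (pp. 61–62)] [cite: Wagner2006, Thm. 5.8(d), §5.3] -/
theorem realEnv_andDel_nonneg (hF : IsTTSP F a b) (hy : s(uy, vy) ∈ F) (hz : s(uz, vz) ∈ F) (hyz : s(uy, vy) ≠ s(uz, vz))
    (hM : M ⊆ (F.erase s(uy, vy)).erase s(uz, vz)) (hC : C ⊆ (F.erase s(uy, vy)).erase s(uz, vz)) (hMC : Disjoint M C)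
    {h : ↥M.powerset → ℝ} (mh : Monotone h) (J : ℤ) :
    0 ≤ ∑ β, h β * (realEnv M C a b s(uy, vy) s(uz, vz) β).andDel J := by
  have hMF : M ⊆ F := hM.trans ((Finset.erase_subset _ _).trans (Finset.erase_subset _ _))
  have hCF : C ⊆ F := hC.trans ((Finset.erase_subset _ _).trans (Finset.erase_subset _ _))
  have hyM : s(uy, vy) ∉ M := fun h => (Finset.mem_erase.1 (Finset.mem_of_mem_erase (hM h))).1 rfl
  have hzM : s(uz, vz) ∉ M := fun h => (Finset.mem_erase.1 (hM h)).1 rfl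
  have hyzM : s(uy, vy) ∉ insert s(uz, vz) M := by rw [Finset.mem_insert, not_or]; exact ⟨hyz, hyM⟩
  have hA : insert s(uy, vy) (insert s(uz, vz) C) ⊆ insert s(a, b) F :=
    (Finset.insert_subset hy (Finset.insert_subset hz hCF)).trans (Finset.subset_insert _ _)
  have hNA : Disjoint M (insert s(uy, vy) (insert s(uz, vz) C)) :=
    Finset.disjoint_insert_right.2 ⟨hyM, Finset.disjoint_insert_right.2 ⟨hzM, hMC⟩⟩
  have key := andGenW_rootless_nonpos_of_isTTSP hF hMF hA
    ((Finset.subset_insert _ _).trans (Finset.subset_insert _ _)) hNA (w := fun n : ℕ => if (n : ℤ) + 0 ≤ J then (1 : ℝ) else 0)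
    (levelWeight_antitone 0 J) (extWeight_mono mh)
  rw [← Finset.sum_coe_sort] at key
  have hneg : ∑ β : ↥M.powerset, h β * (realEnv M C a b s(uy, vy) s(uz, vz) β).andDel J =
      -∑ i : ↥M.powerset, ((fun n : ℕ => if (n : ℤ) + 0 ≤ J then (1 : ℝ) else 0)
          (clusterCount (↑(i.1 ∪ insert s(uy, vy) (insert s(uz, vz) C)) : BondConfig V) ∅ +
            clusterCount (↑(M \ i.1 ∪ C) : BondConfig V) ∅) -
        (fun n : ℕ => if (n : ℤ) + 0 ≤ J then (1 : ℝ) else 0)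
          (clusterCount (↑(M \ i.1 ∪ insert s(uy, vy) (insert s(uz, vz) C)) : BondConfig V) ∅ +
            clusterCount (↑(i.1 ∪ C) : BondConfig V) ∅)) *
        h ⟨i.1 ∩ M, Finset.mem_powerset.2 Finset.inter_subset_right⟩ := by
    rw [← Finset.sum_neg_distrib]
    refine Finset.sum_congr rfl fun β _ => ?_
    rw [extWeight_apply h β]
    have hX : β.1 ⊆ M := Finset.mem_powerset.1 β.2
    have hyX : s(uy, vy) ∉ β.1 := fun h => hyM (hX h)
    have hzX : s(uz, vz) ∉ β.1 := fun h => hzM (hX h)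
    have hyzX : s(uy, vy) ∉ insert s(uz, vz) β.1 := by rw [Finset.mem_insert, not_or]; exact ⟨hyz, hyX⟩
    simp only [realEnv, realPDat, EDat.andDel, PDat.adel, ind, apExpC, add_zero, Finset.insert_sdiff_insert,
      Finset.sdiff_insert_of_notMem hyzM, Finset.sdiff_insert_of_notMem hzM, Finset.insert_sdiff_of_notMem _ hyX,
      Finset.insert_sdiff_of_notMem _ hzX, Finset.insert_union, Finset.union_insert, Nat.cast_add]
    rw [add_comm (clusterCount (↑(insert s(uy, vy) (insert s(uz, vz) (M \ β.1 ∪ C))) : BondConfig V) ∅ : ℤ)]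
    ring
  rw [hneg]
  linarith

end AndDel

section AndApex

variable {F M C : Finset (Sym2 V)} {a b uy vy uz vz : V} {U : Type*} [Fintype U] {j : V ↪ U} {r : U}

omit [Fintype V] in
/-- threshold bookkeeping, apex path contracted on both sides. [folklore] -/
theorem apexCon_le_iff {k1 k2 l1 l2 n : ℕ} {p q : Prop} {_ : Decidable p} {_ : Decidable q} {J : ℤ}
    (h1 : k1 + (if p then 1 else 2) = l1 + n) (h2 : k2 + (if q then 1 else 2) = l2 + n) :
    ((k1 + k2 : ℕ) : ℤ) + (4 - 2 * (n : ℤ)) ≤ J ↔ ((l1 + l2 : ℕ) : ℤ) + (if p then 1 else 0) + (if q then 1 else 0) ≤ J := by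
  by_cases hp : p <;> by_cases hq : q <;> simp only [hp, hq, if_true, if_false] at h1 h2 ⊢ <;> push_cast <;> omega

omit [Fintype V] [Fintype U] in
/-- image of a union with two specials inserted. [folklore] -/
theorem map_insert₂_union (y z : Sym2 V) (X C : Finset (Sym2 V)) :
    (insert y (insert z X) ∪ C).map j.sym2Map = insert (j.sym2Map y) (insert (j.sym2Map z) (X.map j.sym2Map ∪ C.map j.sym2Map)) := by
  rw [Finset.map_union, Finset.map_insert, Finset.map_insert, Finset.insert_union, Finset.insert_union]

/-- **Fact 4 (contracted root) for a real environment, along an embedding with a fresh apex.**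
[cite: Grimmett2006, §3.8 Thm. (3.90) (pp. 61–62)] [cite: Wagner2006, Thm. 5.8(d), §5.3] -/
theorem realEnv_andCon_apex (hr : r ∉ Set.range j) (hF : IsTTSP F a b) (hy : s(uy, vy) ∈ F) (hz : s(uz, vz) ∈ F)
    (hyz : s(uy, vy) ≠ s(uz, vz)) (hM : M ⊆ (F.erase s(uy, vy)).erase s(uz, vz)) (hC : C ⊆ (F.erase s(uy, vy)).erase s(uz, vz))
    (hMC : Disjoint M C) {h : ↥M.powerset → ℝ} (mh : Monotone h) (J : ℤ) :
    0 ≤ ∑ β, h β * (realEnv M C a b s(uy, vy) s(uz, vz) β).andCon J := by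
  have hMF : M ⊆ F := hM.trans ((Finset.erase_subset _ _).trans (Finset.erase_subset _ _))
  have hCF : C ⊆ F := hC.trans ((Finset.erase_subset _ _).trans (Finset.erase_subset _ _))
  have hyM : s(uy, vy) ∉ M := fun h => (Finset.mem_erase.1 (Finset.mem_of_mem_erase (hM h))).1 rfl
  have hzM : s(uz, vz) ∉ M := fun h => (Finset.mem_erase.1 (hM h)).1 rfl
  have hyzM : s(uy, vy) ∉ insert s(uz, vz) M := by rw [Finset.mem_insert, not_or]; exact ⟨hyz, hyM⟩
  obtain ⟨N0, hN0⟩ : ∃ N0, Nat.card {x : U // x ∉ Set.range j} = N0 := ⟨_, rfl⟩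
  have hE := isTTSP_map_apex hF hr
  -- the sets of the rootless AND theorem on the apex host
  have hNF : M.map j.sym2Map ⊆ F.map j.sym2Map ∪ ({s(j a, r)} ∪ {s(r, j b)}) :=
    (Finset.map_subset_map.2 hMF).trans Finset.subset_union_left
  have hCU : C.map j.sym2Map ∪ ({s(j a, r)} ∪ {s(r, j b)}) ⊆ F.map j.sym2Map ∪ ({s(j a, r)} ∪ {s(r, j b)}) :=
    Finset.union_subset_union (Finset.map_subset_map.2 hCF) le_rfl
  have hA : insert (j.sym2Map s(uy, vy)) (insert (j.sym2Map s(uz, vz)) (C.map j.sym2Map ∪ ({s(j a, r)} ∪ {s(r, j b)}))) ⊆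
      insert s(j a, j b) (F.map j.sym2Map ∪ ({s(j a, r)} ∪ {s(r, j b)})) :=
    (Finset.insert_subset (Finset.mem_union_left _ ((Finset.mem_map' _).2 hy))
      (Finset.insert_subset (Finset.mem_union_left _ ((Finset.mem_map' _).2 hz)) hCU)).trans (Finset.subset_insert _ _)
  have hNA : Disjoint (M.map j.sym2Map)
      (insert (j.sym2Map s(uy, vy)) (insert (j.sym2Map s(uz, vz)) (C.map j.sym2Map ∪ ({s(j a, r)} ∪ {s(r, j b)})))) := by
    rw [Finset.disjoint_insert_right, Finset.disjoint_insert_right, Finset.disjoint_union_right, Finset.disjoint_union_right,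
      Finset.disjoint_singleton_right, Finset.disjoint_singleton_right, Finset.mem_map', Finset.mem_map']
    exact ⟨hyM, hzM, (Finset.disjoint_map _).2 hMC, fun h => apex_notMem_of_mem_map hr M _ h (Sym2.mem_mk_right _ _),
      fun h => apex_notMem_of_mem_map hr M _ h (Sym2.mem_mk_left _ _)⟩
  have key := andGenW_rootless_nonpos_of_isTTSP hE hNF hA
    ((Finset.subset_insert _ _).trans (Finset.subset_insert _ _)) hNA
    (w := fun n : ℕ => if (n : ℤ) + (4 - 2 * (N0 : ℤ)) ≤ J then (1 : ℝ) else 0) (levelWeight_antitone _ J)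
    (h := fun X' => h ⟨(Finset.univ.filter fun e : Sym2 V => j.sym2Map e ∈ X') ∩ M, Finset.mem_powerset.2 Finset.inter_subset_right⟩)
    (fun X' Y' hXY _ => pullWeight_mono mh hXY)
  rw [← sum_powerset_map, ← Finset.sum_coe_sort] at key
  have hneg : ∑ β : ↥M.powerset, h β * (realEnv M C a b s(uy, vy) s(uz, vz) β).andCon J =
      -∑ i : ↥M.powerset, ((fun n : ℕ => if (n : ℤ) + (4 - 2 * (N0 : ℤ)) ≤ J then (1 : ℝ) else 0)
          (clusterCount (↑(i.1.map j.sym2Map ∪ insert (j.sym2Map s(uy, vy)) (insert (j.sym2Map s(uz, vz))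
              (C.map j.sym2Map ∪ ({s(j a, r)} ∪ {s(r, j b)})))) : BondConfig U) ∅ +
            clusterCount (↑(M.map j.sym2Map \ i.1.map j.sym2Map ∪ (C.map j.sym2Map ∪ ({s(j a, r)} ∪ {s(r, j b)}))) : BondConfig U) ∅) -
        (fun n : ℕ => if (n : ℤ) + (4 - 2 * (N0 : ℤ)) ≤ J then (1 : ℝ) else 0)
          (clusterCount (↑(M.map j.sym2Map \ i.1.map j.sym2Map ∪ insert (j.sym2Map s(uy, vy)) (insert (j.sym2Map s(uz, vz))
              (C.map j.sym2Map ∪ ({s(j a, r)} ∪ {s(r, j b)})))) : BondConfig U) ∅ +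
            clusterCount (↑(i.1.map j.sym2Map ∪ (C.map j.sym2Map ∪ ({s(j a, r)} ∪ {s(r, j b)}))) : BondConfig U) ∅)) *
        h ⟨(Finset.univ.filter fun e : Sym2 V => j.sym2Map e ∈ i.1.map j.sym2Map) ∩ M, Finset.mem_powerset.2 Finset.inter_subset_right⟩ := by
    rw [← Finset.sum_neg_distrib]
    refine Finset.sum_congr rfl fun β _ => ?_
    rw [pullWeight_map h β]
    have hX : β.1 ⊆ M := Finset.mem_powerset.1 β.2
    have hyX : s(uy, vy) ∉ β.1 := fun h => hyM (hX h)
    have hzX : s(uz, vz) ∉ β.1 := fun h => hzM (hX h)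
    -- the four replica sets of the apex host, as images
    have e1 : β.1.map j.sym2Map ∪ insert (j.sym2Map s(uy, vy)) (insert (j.sym2Map s(uz, vz)) (C.map j.sym2Map ∪ ({s(j a, r)} ∪ {s(r, j b)}))) =
        insert s(r, j b) (insert s(j a, r) ((insert s(uy, vy) (insert s(uz, vz) β.1) ∪ C).map j.sym2Map)) := by
      rw [map_insert₂_union]; simp only [Finset.insert_eq]; ac_rfl
    have e2 : M.map j.sym2Map \ β.1.map j.sym2Map ∪ (C.map j.sym2Map ∪ ({s(j a, r)} ∪ {s(r, j b)})) =
        insert s(r, j b) (insert s(j a, r) ((insert s(uy, vy) (insert s(uz, vz) M) \ insert s(uy, vy) (insert s(uz, vz) β.1) ∪ C).map j.sym2Map)) := by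
      rw [Finset.insert_sdiff_insert, Finset.sdiff_insert_of_notMem hyzM, Finset.insert_sdiff_insert, Finset.sdiff_insert_of_notMem hzM,
        Finset.map_union, ← map_sdiff_sym2Map]
      simp only [Finset.insert_eq]; ac_rfl
    have e3 : M.map j.sym2Map \ β.1.map j.sym2Map ∪ insert (j.sym2Map s(uy, vy)) (insert (j.sym2Map s(uz, vz))
          (C.map j.sym2Map ∪ ({s(j a, r)} ∪ {s(r, j b)}))) =
        insert s(r, j b) (insert s(j a, r) ((insert s(uy, vy) (insert s(uz, vz) M) \ β.1 ∪ C).map j.sym2Map)) := by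
      rw [Finset.insert_sdiff_of_notMem _ hyX, Finset.insert_sdiff_of_notMem _ hzX, map_insert₂_union, ← map_sdiff_sym2Map]
      simp only [Finset.insert_eq]; ac_rfl
    have e4 : β.1.map j.sym2Map ∪ (C.map j.sym2Map ∪ ({s(j a, r)} ∪ {s(r, j b)})) =
        insert s(r, j b) (insert s(j a, r) ((β.1 ∪ C).map j.sym2Map)) := by
      rw [Finset.map_union]; simp only [Finset.insert_eq]; ac_rfl
    have k1 := clusterCount_insert_apex₂ hr (insert s(uy, vy) (insert s(uz, vz) β.1) ∪ C) a b
    have k2 := clusterCount_insert_apex₂ hr (insert s(uy, vy) (insert s(uz, vz) M) \ insert s(uy, vy) (insert s(uz, vz) β.1) ∪ C) a b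
    have k3 := clusterCount_insert_apex₂ hr (insert s(uy, vy) (insert s(uz, vz) M) \ β.1 ∪ C) a b
    have k4 := clusterCount_insert_apex₂ hr (β.1 ∪ C) a b
    rw [clusterCount_map_eq, hN0] at k1 k2 k3 k4
    rw [e1, e2, e3, e4]
    simp only [apexCon_le_iff k1 k2, apexCon_le_iff k3 k4]
    simp only [realEnv, realPDat, EDat.andCon, PDat.acon, ind, bit, reachB, apExpC, decide_eq_true_eq]
    rw [Nat.add_comm (clusterCount (↑(insert s(uy, vy) (insert s(uz, vz) M) \ β.1 ∪ C) : BondConfig V) ∅)]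
    ring
  rw [hneg]
  linarith

omit [Fintype V] in
/-- threshold bookkeeping, half-free apex path: pendant side first, path side second. [folklore] -/
theorem apexFree_le_iff₁ {k1 k2 l1 l2 n : ℕ} {q : Prop} {_ : Decidable q} {J : ℤ}
    (h1 : k1 + 1 = l1 + n) (h2 : k2 + (if q then 1 else 2) = l2 + n) :
    ((k1 + k2 : ℕ) : ℤ) + (3 - 2 * (n : ℤ)) ≤ J ↔ ((l1 + l2 : ℕ) : ℤ) + (if q then 1 else 0) ≤ J := by
  by_cases hq : q <;> simp only [hq, if_true, if_false] at h2 ⊢ <;> push_cast <;> omega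

omit [Fintype V] in
/-- threshold bookkeeping, half-free apex path: path side first, pendant side second, levels swapped. [folklore] -/
theorem apexFree_le_iff₂ {k1 k2 l1 l2 n : ℕ} {p : Prop} {_ : Decidable p} {J : ℤ}
    (h1 : k1 + (if p then 1 else 2) = l1 + n) (h2 : k2 + 1 = l2 + n) :
    ((k1 + k2 : ℕ) : ℤ) + (3 - 2 * (n : ℤ)) ≤ J ↔ ((l2 + l1 : ℕ) : ℤ) + (if p then 1 else 0) ≤ J := by
  by_cases hp : p <;> simp only [hp, if_true, if_false] at h1 ⊢ <;> push_cast <;> omega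

omit [Fintype V] in
/-- threshold bookkeeping, half-free apex path: path side first, pendant side second. [folklore] -/
theorem apexFree_le_iff₃ {k1 k2 l1 l2 n : ℕ} {p : Prop} {_ : Decidable p} {J : ℤ}
    (h1 : k1 + (if p then 1 else 2) = l1 + n) (h2 : k2 + 1 = l2 + n) :
    ((k1 + k2 : ℕ) : ℤ) + (3 - 2 * (n : ℤ)) ≤ J ↔ ((l1 + l2 : ℕ) : ℤ) + (if p then 1 else 0) ≤ J := by
  by_cases hp : p <;> simp only [hp, if_true, if_false] at h1 ⊢ <;> push_cast <;> omega

omit [Fintype V] in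
/-- threshold bookkeeping, half-free apex path: pendant side first, path side second, levels swapped. [folklore] -/
theorem apexFree_le_iff₄ {k1 k2 l1 l2 n : ℕ} {q : Prop} {_ : Decidable q} {J : ℤ}
    (h1 : k1 + 1 = l1 + n) (h2 : k2 + (if q then 1 else 2) = l2 + n) :
    ((k1 + k2 : ℕ) : ℤ) + (3 - 2 * (n : ℤ)) ≤ J ↔ ((l2 + l1 : ℕ) : ℤ) + (if q then 1 else 0) ≤ J := by
  by_cases hq : q <;> simp only [hq, if_true, if_false] at h2 ⊢ <;> push_cast <;> omega

/-- **Fact 5 (free root, nested) for a real environment, along an embedding with a fresh apex.**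
`0 ≤ Σ_β (h₁(β)·([Λ_∅+K¹_∅ ≤ J] − [Λ_yz+K¹_yz ≤ J]) + h₀(β)·([Λ_∅+K²_∅ ≤ J] − [Λ_yz+K²_yz ≤ J]))` for monotone `h₀ ≤ h₁`.
[cite: Grimmett2006, §3.8 Thm. (3.90) (pp. 61–62)] [cite: Wagner2006, Thm. 5.8(d), §5.3] -/
theorem realEnv_andFree_apex (hr : r ∉ Set.range j) (hF : IsTTSP F a b) (hy : s(uy, vy) ∈ F) (hz : s(uz, vz) ∈ F)
    (hyz : s(uy, vy) ≠ s(uz, vz)) (hM : M ⊆ (F.erase s(uy, vy)).erase s(uz, vz)) (hC : C ⊆ (F.erase s(uy, vy)).erase s(uz, vz))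
    (hMC : Disjoint M C) {h0 h1 : ↥M.powerset → ℝ} (m0 : Monotone h0) (m1 : Monotone h1) (le : ∀ β, h0 β ≤ h1 β) (J : ℤ) :
    0 ≤ ∑ β, (h1 β * (realEnv M C a b s(uy, vy) s(uz, vz) β).andE1 J + h0 β * (realEnv M C a b s(uy, vy) s(uz, vz) β).andE2 J) := by
  have hMF : M ⊆ F := hM.trans ((Finset.erase_subset _ _).trans (Finset.erase_subset _ _))
  have hCF : C ⊆ F := hC.trans ((Finset.erase_subset _ _).trans (Finset.erase_subset _ _))
  have hyM : s(uy, vy) ∉ M := fun h => (Finset.mem_erase.1 (Finset.mem_of_mem_erase (hM h))).1 rfl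
  have hzM : s(uz, vz) ∉ M := fun h => (Finset.mem_erase.1 (hM h)).1 rfl
  have hyzM : s(uy, vy) ∉ insert s(uz, vz) M := by rw [Finset.mem_insert, not_or]; exact ⟨hyz, hyM⟩
  obtain ⟨N0, hN0⟩ : ∃ N0, Nat.card {x : U // x ∉ Set.range j} = N0 := ⟨_, rfl⟩
  have hE := isTTSP_map_apex hF hr
  have heM : s(j a, r) ∉ M.map j.sym2Map := fun h => apex_notMem_of_mem_map hr M _ h (Sym2.mem_mk_right _ _)
  have heF : s(j a, r) ∈ F.map j.sym2Map ∪ ({s(j a, r)} ∪ {s(r, j b)}) :=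
    Finset.mem_union_right _ (Finset.mem_union_left _ (Finset.mem_singleton_self _))
  have hfF : s(r, j b) ∈ F.map j.sym2Map ∪ ({s(j a, r)} ∪ {s(r, j b)}) :=
    Finset.mem_union_right _ (Finset.mem_union_right _ (Finset.mem_singleton_self _))
  have hNF : insert s(j a, r) (M.map j.sym2Map) ⊆ F.map j.sym2Map ∪ ({s(j a, r)} ∪ {s(r, j b)}) :=
    Finset.insert_subset heF ((Finset.map_subset_map.2 hMF).trans Finset.subset_union_left)
  have hCU : C.map j.sym2Map ∪ {s(r, j b)} ⊆ F.map j.sym2Map ∪ ({s(j a, r)} ∪ {s(r, j b)}) :=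
    Finset.union_subset ((Finset.map_subset_map.2 hCF).trans Finset.subset_union_left) (Finset.singleton_subset_iff.2 hfF)
  have hA : insert (j.sym2Map s(uy, vy)) (insert (j.sym2Map s(uz, vz)) (C.map j.sym2Map ∪ {s(r, j b)})) ⊆
      insert s(j a, j b) (F.map j.sym2Map ∪ ({s(j a, r)} ∪ {s(r, j b)})) :=
    (Finset.insert_subset (Finset.mem_union_left _ ((Finset.mem_map' _).2 hy))
      (Finset.insert_subset (Finset.mem_union_left _ ((Finset.mem_map' _).2 hz)) hCU)).trans (Finset.subset_insert _ _)
  have hNA : Disjoint (insert s(j a, r) (M.map j.sym2Map))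
      (insert (j.sym2Map s(uy, vy)) (insert (j.sym2Map s(uz, vz)) (C.map j.sym2Map ∪ {s(r, j b)}))) := by
    rw [Finset.disjoint_insert_left, Finset.disjoint_insert_right, Finset.disjoint_insert_right, Finset.disjoint_union_right,
      Finset.disjoint_singleton_right, Finset.mem_map', Finset.mem_map', Finset.mem_insert, Finset.mem_insert, Finset.mem_union,
      Finset.mem_singleton]
    refine ⟨?_, hyM, hzM, (Finset.disjoint_map _).2 hMC, fun h => apex_notMem_of_mem_map hr M _ h (Sym2.mem_mk_left _ _)⟩
    rintro (h | h | h | h)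
    · exact apex_notMem_of_mem_map hr {s(uy, vy)} _ (by rw [Finset.map_singleton]; exact Finset.mem_singleton.2 h) (Sym2.mem_mk_right _ _)
    · exact apex_notMem_of_mem_map hr {s(uz, vz)} _ (by rw [Finset.map_singleton]; exact Finset.mem_singleton.2 h) (Sym2.mem_mk_right _ _)
    · exact apex_notMem_of_mem_map hr C _ h (Sym2.mem_mk_right _ _)
    · have hcr : j a ≠ r := fun h' => hr ⟨a, h'⟩
      rw [Sym2.eq_iff] at h
      rcases h with ⟨h', _⟩ | ⟨h', _⟩
      · exact hcr h'
      · exact hF.ne (j.injective h')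
  have key := andGenW_rootless_nonpos_of_isTTSP hE hNF hA
    ((Finset.subset_insert _ _).trans (Finset.subset_insert _ _)) hNA
    (w := fun n : ℕ => if (n : ℤ) + (3 - 2 * (N0 : ℤ)) ≤ J then (1 : ℝ) else 0) (levelWeight_antitone _ J)
    (h := fun X' => if s(j a, r) ∈ X' then
        h1 ⟨(Finset.univ.filter fun e : Sym2 V => j.sym2Map e ∈ X'.erase s(j a, r)) ∩ M, Finset.mem_powerset.2 Finset.inter_subset_right⟩
      else h0 ⟨(Finset.univ.filter fun e : Sym2 V => j.sym2Map e ∈ X') ∩ M, Finset.mem_powerset.2 Finset.inter_subset_right⟩)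
    (nestedTest_mono s(j a, r)
      (h₀ := fun X' => h0 ⟨(Finset.univ.filter fun e : Sym2 V => j.sym2Map e ∈ X') ∩ M, Finset.mem_powerset.2 Finset.inter_subset_right⟩)
      (h₁ := fun X' => h1 ⟨(Finset.univ.filter fun e : Sym2 V => j.sym2Map e ∈ X') ∩ M, Finset.mem_powerset.2 Finset.inter_subset_right⟩)
      (fun A _ => le _) (fun X' Y' hXY _ => pullWeight_mono m0 hXY) (fun X' Y' hXY _ => pullWeight_mono m1 hXY))
  rw [Finset.sum_powerset_insert heM, ← Finset.sum_add_distrib, ← sum_powerset_map, ← Finset.sum_coe_sort] at key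
  rw [← sub_nonneg, zero_sub, ← Finset.sum_neg_distrib] at key
  refine key.trans_eq (Finset.sum_congr rfl fun β _ => ?_)
  have hX : β.1 ⊆ M := Finset.mem_powerset.1 β.2
  have hyX : s(uy, vy) ∉ β.1 := fun h => hyM (hX h)
  have hzX : s(uz, vz) ∉ β.1 := fun h => hzM (hX h)
  have n0 : s(j a, r) ∉ β.1.map j.sym2Map := fun h => apex_notMem_of_mem_map hr β.1 _ h (Sym2.mem_mk_right _ _)
  rw [if_neg n0, if_pos (Finset.mem_insert_self _ _), Finset.erase_insert n0, pullWeight_map h0 β, pullWeight_map h1 β]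
  -- the eight replica sets of the apex host, as images
  have s1 : β.1.map j.sym2Map ∪ insert (j.sym2Map s(uy, vy)) (insert (j.sym2Map s(uz, vz)) (C.map j.sym2Map ∪ {s(r, j b)})) =
      insert s(j b, r) ((insert s(uy, vy) (insert s(uz, vz) β.1) ∪ C).map j.sym2Map) := by
    rw [map_insert₂_union, show s(r, j b) = s(j b, r) from Sym2.eq_swap]; simp only [Finset.insert_eq]; ac_rfl
  have s2 : insert s(j a, r) (M.map j.sym2Map) \ β.1.map j.sym2Map ∪ (C.map j.sym2Map ∪ {s(r, j b)}) =
      insert s(r, j b) (insert s(j a, r) ((insert s(uy, vy) (insert s(uz, vz) M) \ insert s(uy, vy) (insert s(uz, vz) β.1) ∪ C).map j.sym2Map)) := by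
    rw [Finset.insert_sdiff_of_notMem _ n0, Finset.insert_sdiff_insert, Finset.sdiff_insert_of_notMem hyzM, Finset.insert_sdiff_insert,
      Finset.sdiff_insert_of_notMem hzM, Finset.map_union, ← map_sdiff_sym2Map]
    simp only [Finset.insert_eq]; ac_rfl
  have s3 : insert s(j a, r) (M.map j.sym2Map) \ β.1.map j.sym2Map ∪ insert (j.sym2Map s(uy, vy)) (insert (j.sym2Map s(uz, vz))
        (C.map j.sym2Map ∪ {s(r, j b)})) =
      insert s(r, j b) (insert s(j a, r) ((insert s(uy, vy) (insert s(uz, vz) M) \ β.1 ∪ C).map j.sym2Map)) := by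
    rw [Finset.insert_sdiff_of_notMem _ n0, Finset.insert_sdiff_of_notMem _ hyX, Finset.insert_sdiff_of_notMem _ hzX, map_insert₂_union,
      ← map_sdiff_sym2Map]
    simp only [Finset.insert_eq]; ac_rfl
  have s4 : β.1.map j.sym2Map ∪ (C.map j.sym2Map ∪ {s(r, j b)}) = insert s(j b, r) ((β.1 ∪ C).map j.sym2Map) := by
    rw [Finset.map_union, show s(r, j b) = s(j b, r) from Sym2.eq_swap]; simp only [Finset.insert_eq]; ac_rfl
  have s5 : insert s(j a, r) (β.1.map j.sym2Map) ∪ insert (j.sym2Map s(uy, vy)) (insert (j.sym2Map s(uz, vz)) (C.map j.sym2Map ∪ {s(r, j b)})) =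
      insert s(r, j b) (insert s(j a, r) ((insert s(uy, vy) (insert s(uz, vz) β.1) ∪ C).map j.sym2Map)) := by
    rw [map_insert₂_union]; simp only [Finset.insert_eq]; ac_rfl
  have s6 : insert s(j a, r) (M.map j.sym2Map) \ insert s(j a, r) (β.1.map j.sym2Map) ∪ (C.map j.sym2Map ∪ {s(r, j b)}) =
      insert s(j b, r) ((insert s(uy, vy) (insert s(uz, vz) M) \ insert s(uy, vy) (insert s(uz, vz) β.1) ∪ C).map j.sym2Map) := by
    rw [Finset.insert_sdiff_insert, Finset.sdiff_insert_of_notMem heM, Finset.insert_sdiff_insert, Finset.sdiff_insert_of_notMem hyzM,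
      Finset.insert_sdiff_insert, Finset.sdiff_insert_of_notMem hzM, Finset.map_union, ← map_sdiff_sym2Map,
      show s(r, j b) = s(j b, r) from Sym2.eq_swap]
    simp only [Finset.insert_eq]; ac_rfl
  have s7 : insert s(j a, r) (M.map j.sym2Map) \ insert s(j a, r) (β.1.map j.sym2Map) ∪ insert (j.sym2Map s(uy, vy))
        (insert (j.sym2Map s(uz, vz)) (C.map j.sym2Map ∪ {s(r, j b)})) =
      insert s(j b, r) ((insert s(uy, vy) (insert s(uz, vz) M) \ β.1 ∪ C).map j.sym2Map) := by
    rw [Finset.insert_sdiff_insert, Finset.sdiff_insert_of_notMem heM, Finset.insert_sdiff_of_notMem _ hyX,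
      Finset.insert_sdiff_of_notMem _ hzX, map_insert₂_union, ← map_sdiff_sym2Map,
      show s(r, j b) = s(j b, r) from Sym2.eq_swap]
    simp only [Finset.insert_eq]; ac_rfl
  have s8 : insert s(j a, r) (β.1.map j.sym2Map) ∪ (C.map j.sym2Map ∪ {s(r, j b)}) =
      insert s(r, j b) (insert s(j a, r) ((β.1 ∪ C).map j.sym2Map)) := by
    rw [Finset.map_union]; simp only [Finset.insert_eq]; ac_rfl
  have k1 := clusterCount_insert_apex₁ hr (insert s(uy, vy) (insert s(uz, vz) β.1) ∪ C) b
  have k2 := clusterCount_insert_apex₂ hr (insert s(uy, vy) (insert s(uz, vz) M) \ insert s(uy, vy) (insert s(uz, vz) β.1) ∪ C) a b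
  have k3 := clusterCount_insert_apex₂ hr (insert s(uy, vy) (insert s(uz, vz) M) \ β.1 ∪ C) a b
  have k4 := clusterCount_insert_apex₁ hr (β.1 ∪ C) b
  have k5 := clusterCount_insert_apex₂ hr (insert s(uy, vy) (insert s(uz, vz) β.1) ∪ C) a b
  have k6 := clusterCount_insert_apex₁ hr (insert s(uy, vy) (insert s(uz, vz) M) \ insert s(uy, vy) (insert s(uz, vz) β.1) ∪ C) b
  have k7 := clusterCount_insert_apex₁ hr (insert s(uy, vy) (insert s(uz, vz) M) \ β.1 ∪ C) b
  have k8 := clusterCount_insert_apex₂ hr (β.1 ∪ C) a b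
  rw [clusterCount_map_eq, hN0] at k1 k2 k3 k4 k5 k6 k7 k8
  rw [s1, s2, s3, s4, s5, s6, s7, s8]
  simp only [apexFree_le_iff₁ k1 k2, apexFree_le_iff₂ k3 k4, apexFree_le_iff₃ k5 k6, apexFree_le_iff₄ k7 k8]
  simp only [realEnv, realPDat, EDat.andE1, EDat.andE2, PDat.a1, PDat.a2, ind, bit, reachB, apExpC, decide_eq_true_eq]
  ring

end AndApex

section AndFinal

variable {F M C : Finset (Sym2 V)} {a b uy vy uz vz : V}

/-- **Fact 4 (contracted root) for a real environment.** [cite: Grimmett2006, §3.8 Thm. (3.90) (pp. 61–62)] [cite: Wagner2006, Thm. 5.8(d), §5.3] -/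
theorem realEnv_andCon_nonneg (hF : IsTTSP F a b) (hy : s(uy, vy) ∈ F) (hz : s(uz, vz) ∈ F) (hyz : s(uy, vy) ≠ s(uz, vz))
    (hM : M ⊆ (F.erase s(uy, vy)).erase s(uz, vz)) (hC : C ⊆ (F.erase s(uy, vy)).erase s(uz, vz)) (hMC : Disjoint M C)
    {h : ↥M.powerset → ℝ} (mh : Monotone h) (J : ℤ) :
    0 ≤ ∑ β, h β * (realEnv M C a b s(uy, vy) s(uz, vz) β).andCon J :=
  realEnv_andCon_apex none_notMem_range_some hF hy hz hyz hM hC hMC mh J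

/-- **Fact 5 (free root, nested) for a real environment.** [cite: Grimmett2006, §3.8 Thm. (3.90) (pp. 61–62)] [cite: Wagner2006, Thm. 5.8(d), §5.3] -/
theorem realEnv_andFree_nonneg (hF : IsTTSP F a b) (hy : s(uy, vy) ∈ F) (hz : s(uz, vz) ∈ F) (hyz : s(uy, vy) ≠ s(uz, vz))
    (hM : M ⊆ (F.erase s(uy, vy)).erase s(uz, vz)) (hC : C ⊆ (F.erase s(uy, vy)).erase s(uz, vz)) (hMC : Disjoint M C)
    {h0 h1 : ↥M.powerset → ℝ} (m0 : Monotone h0) (m1 : Monotone h1) (le : ∀ β, h0 β ≤ h1 β) (J : ℤ) :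
    0 ≤ ∑ β, (h1 β * (realEnv M C a b s(uy, vy) s(uz, vz) β).andE1 J + h0 β * (realEnv M C a b s(uy, vy) s(uz, vz) β).andE2 J) :=
  realEnv_andFree_apex none_notMem_range_some hF hy hz hyz hM hC hMC m0 m1 le J

end AndFinal

end RootForm

end FK

end Summit.CriticalPhenomena.PercolationContinuityZ3.Theorems

end
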